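import Summits.NavierStokesRegularity.NavierStokesRegularity.Theorems.TypeICertificateLadderNoBlowupToClay
import Literature.Analysis.FluidPDE.KNSSTypeIIHolds
import HarnessLib

/-!
# Bridge «a-priori sup-norm bound for classical Leray–Hopf solutions ⇒ Clay (A)»

Companion of the `L³` / `Ḣ^{1/2}` / `H^{1/2}` bridges (`Theorems/StrongHypothesesLerayHopf*Bridge.lean`,
p458363 / p458804 / p461705). Several claimed regularity proofs adjudicated by cell `ns-claims`
(D-0090) assert an A-PRIORI `L^∞` BOUND for smooth (suitable / classical Leray–Hopf) solutions of the
unforced system — claims C10 (`sup_{ℝ³×[0,T]}|u| ≤ C(ν,T,‖u₀‖_∞,‖u₀‖₂)`), C23 (`sup_{[0,T]}‖u‖_∞ ≤ B̌`),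
C71 (maximum principle) — and conclude global regularity. This file records, in the kernel, the TRUE
implication «such a bound for every classical Leray–Hopf solution from rapidly decaying data ⇒
Fefferman's (A)»: a bounded classical Leray–Hopf solution on `[0,T)` extends smoothly past `T`
(`Literature.Analysis.FluidPDE.hasSmoothExtensionPast_of_bounded_holds`, the tree's discharge of the
bounded-continuation principle over Leray's local `H¹` theory, `KNSSTypeII*.lean`; the statement is
the `L^∞` case `q = r = ∞`-adjacent of the Prodi–Serrin–Ladyzhenskaya continuation principle), and
«no finite-time blow-up ⇒ (A)» is the landed frame `typeICertificateLadder_noBlowupToClay_proof`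
(stmt-NavierStokesRegularity-0055). The hypothesis is written as an explicit binder (no new
definition); it is OPEN (it implies the Millennium problem (A) by this file) — only the implication
is asserted.

WHAT THIS IS NOT: not a claim about NS regularity or blow-up; not a claim about any author beyond the typed locator.

## References

* G. Koch, N. Nadirashvili, G. Seregin, V. Šverák, Acta Math. 203 (2009), §1 (bounded solutions
  are smooth; continuation). [`KochNadirashviliSereginSverak2009`]
* J. Serrin, Arch. Rational Mech. Anal. 9 (1962); O. A. Ladyzhenskaya (1967) — the `L^q_t L^r_x`
  continuation principle. [`Serrin1962`]
-/

noncomputable section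

namespace Summit.NavierStokesRegularity.StrongHypotheses

open Set MeasureTheory
open scoped ENNReal ContDiff
open Literature.Analysis.FluidPDE
open Summit.NavierStokesRegularity.NavierStokesRegularity.Theorems
  (typeICertificateLadder_noBlowupToClay_proof)

/-- **A-priori sup bound ⇒ no blow-up.** If every classical solution `(u, p)` of the unforced
Navier–Stokes system on `ℝ³ × [0,T)` (`ν > 0`) which is Leray–Hopf on `[0,T]` from its rapidly
decaying datum `u 0` is bounded on `[0,T) × ℝ³`, then every such solution extends smoothly past
`T` (bounded continuation, `hasSmoothExtensionPast_of_bounded_holds`).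
[cite: KochNadirashviliSereginSverak2009, §1] -/
theorem noBlowup_of_classicalSupBound
    (H : ∀ (ν T : ℝ), 0 < ν → 0 < T →
      ∀ (u : ℝ → EuclideanSpace ℝ (Fin 3) → EuclideanSpace ℝ (Fin 3))
        (p : ℝ → EuclideanSpace ℝ (Fin 3) → ℝ),
        IsClassicalNSSolutionOn (Ico 0 T) ν 0 u p → IsLerayHopfOn T ν 0 (u 0) u →
          HasRapidSpatialDecay (u 0) → ∃ M : ℝ, ∀ t ∈ Ico 0 T, ∀ x, ‖u t x‖ ≤ M) :
    ∀ (ν T : ℝ), 0 < ν → 0 < T →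
      ∀ (u : ℝ → EuclideanSpace ℝ (Fin 3) → EuclideanSpace ℝ (Fin 3))
        (p : ℝ → EuclideanSpace ℝ (Fin 3) → ℝ),
        IsClassicalNSSolutionOn (Ico 0 T) ν 0 u p → IsLerayHopfOn T ν 0 (u 0) u →
          HasRapidSpatialDecay (u 0) → HasSmoothExtensionPast ν 0 u T :=
  fun ν T hν hT u p hcl hLH hdec =>
    hasSmoothExtensionPast_of_bounded_holds hν hT hcl hLH (H ν T hν hT u p hcl hLH hdec)

/-- **A-priori sup bound for all classical Leray–Hopf solutions from rapidly decaying data ⇒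
Clay (A).** If every classical solution of the unforced Navier–Stokes system on `ℝ³ × [0,T)`,
`ν > 0`, Leray–Hopf on `[0,T]` from its rapidly decaying datum, obeys `sup_{[0,T)×ℝ³} |u| < ∞`, then
Fefferman's Clay statement (A) (`NavierStokesRegularity`) holds: `noBlowup_of_classicalSupBound` and
the landed frame «no blow-up ⇒ (A)» (`typeICertificateLadder_noBlowupToClay_proof`). The hypothesis
is the common shape of claimed a-priori `L^∞` bounds (cell `ns-claims`: C10, C23, C71); it is open,
only the implication is asserted. [cite: KochNadirashviliSereginSverak2009, §1] -/
theorem navierStokesRegularity_of_classicalSupBound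
    (H : ∀ (ν T : ℝ), 0 < ν → 0 < T →
      ∀ (u : ℝ → EuclideanSpace ℝ (Fin 3) → EuclideanSpace ℝ (Fin 3))
        (p : ℝ → EuclideanSpace ℝ (Fin 3) → ℝ),
        IsClassicalNSSolutionOn (Ico 0 T) ν 0 u p → IsLerayHopfOn T ν 0 (u 0) u →
          HasRapidSpatialDecay (u 0) → ∃ M : ℝ, ∀ t ∈ Ico 0 T, ∀ x, ‖u t x‖ ≤ M) :
    _root_.NavierStokesRegularity :=
  typeICertificateLadder_noBlowupToClay_proof (noBlowup_of_classicalSupBound H)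

end Summit.NavierStokesRegularity.StrongHypotheses

end
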